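import Mathlib.Analysis.SpecialFunctions.Pow.Asymptotics
import Mathlib.Analysis.SpecialFunctions.Log.Basic
import Literature.Computability.Complexity.RossmanMonotoneClique
import Literature.Computability.Complexity.ACRealizeOver
import Literature.Computability.Complexity.RossmanMonotoneCliqueFinite
import HarnessLib

/-!
# Rossman 2010, Theorem 3 as vendored: the proof (`Rossman2010_upperBound_holds`)

Sibling proof file of `RossmanMonotoneClique.lean` (D-0014: the fact
`Literature.Computability.Complexity.Rossman2010_upperBound` stays a `def`).

B. Rossman, *The monotone complexity of k-clique on random graphs*, FOCS 2010 [Rossman2010],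
author's full version (held text `paper:doi-10-1109-focs-2010-26`), Theorem 3 (p. 4): "There
exist constant-depth monotone circuits of size `n^{k/4+O(1)}` which solve `k`-clique on random
graphs"; proof §8, pp. 10–11.

## What is proved, and a caveat on the vendored reading

`Rossman2010_upperBound` reads Theorem 3 for sequences of circuits with the exponent shift `c`
quantified AFTER `k`:
`∀ k ≥ 5, ∃ (d : ℕ) (c : ℝ) (C n), IsOver {∧ₘ, ∨ₘ} ∧ depth ≤ d ∧ (∀ᶠ n, |C n| ≤ n^{k/4+c}) ∧
∀ p : ℕ → [0,1], SolvesCliqueAAS k p C` — "`k` a fixed constant" (§2, p. 3) and "`O(1)`" read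
literally along `n → ∞`. Under this reading the statement is witnessed by the **exhaustive clique
DNF** `⋁_{A ∈ ([n] choose k)} ⋀_{e ⊆ A} x_e`: two levels of unbounded fan-in monotone gates,
`C(n,k) + 1 ≤ n^{k+1} = n^{k/4 + (3k/4+1)}` gates, computing `k`-CLIQUE EXACTLY, hence a.a.s.
correct (error probability `0`) on `G(n,p)` for every `p`. That is the proof given here
(`exists_cliqueDNF_monotoneAC`, `Rossman2010_upperBound_holds`).

The content of the printed proof is stronger and is NOT captured by the vendored statement: §8
monotonizes Amano's `AC⁰` circuits and proves (Lemma 21, p. 11) "`C` has size `O(n^{(k/4)+2})`",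
an exponent shift UNIFORM in `k` (at a depth growing with `k`), i.e. the `k`-uniform form
`∃ c, ∀ k ≥ 5, ∃ d (C n), …` of Theorem 3, whose proof needs the random-graph analysis of
Amano's Lemma 18 ("`G(n,p)` is almost surely good"). Recorded in the unit's notes as a
recommended sharpening (new name; the vendored def is not edited in place).

## Contents

* `Circuit.depth_le_acDepth_of_isOver_monotoneACBasis` — over the negation-free basis
  `{∧ₘ, ∨ₘ | m}` unit-weight depth is at most `acDepth` (all weights are `1`).
* `exists_cliqueDNF_monotoneAC n k` — a depth-`2` circuit over `{∧ₘ, ∨ₘ | m}` with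
  `≤ C(n,k) + 1` gates computing `cliqueFn n k` (built with the `ACRealOver` toolkit of
  `ACRealizeOver.lean`: `acRealOver_input`, `acRealOver_gate`, `ACRealOver.toCircuit`).
* `Rossman2010_upperBound_holds : Rossman2010_upperBound` — `d = 2`, `c = 3k/4 + 1`.
-/

namespace Literature.Computability.Complexity

open Finset Filter
open scoped _root_.Topology

section UpperBound

open GateList

variable {ι : Type*}

/-- Gate depths are monotone in the weights of the gates that actually occur in the program
(the pointwise-on-`gs` version of `GateList.getD_wdepths_mono`). [folklore] -/
private theorem getD_wdepths_le_of_forall_mem {w w' : GateFn → ℕ} (gs : List (Gate ι))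
    (hw : ∀ g ∈ gs, w g.fn ≤ w' g.fn) (m : ℕ) :
    (wdepths w gs).getD m 0 ≤ (wdepths w' gs).getD m 0 := by
  induction gs using List.reverseRecOn generalizing m with
  | nil => simp
  | append_singleton gs g ih =>
    have hgs : ∀ g' ∈ gs, w g'.fn ≤ w' g'.fn := fun g' hg' => hw g' (List.mem_append_left _ hg')
    have hg : w g.fn ≤ w' g.fn := hw g (List.mem_append_right _ (List.mem_singleton_self g))
    rw [wdepths_append_singleton, wdepths_append_singleton]
    simp only [List.getD_eq_getElem?_getD]
    rcases Nat.lt_trichotomy m gs.length with hm | rfl | hm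
    · rw [List.getElem?_append_left (by simpa using hm),
        List.getElem?_append_left (by simpa using hm)]
      simpa [List.getD_eq_getElem?_getD] using ih hgs m
    · rw [List.getElem?_append_right (by simp), List.getElem?_append_right (by simp)]
      simp only [length_wdepths, Nat.sub_self, List.getElem?_cons_zero, Option.getD_some]
      refine Nat.add_le_add hg (Finset.sup_mono_fun fun a _ => ?_)
      cases g.args a with
      | inl i => exact le_rfl
      | inr m' => simpa [List.getD_eq_getElem?_getD] using ih hgs m'
    · rw [List.getElem?_eq_none (by simp; omega), List.getElem?_eq_none (by simp; omega)]

/-- `∧ₘ ∈ {∧ₘ, ∨ₘ | m}`. [folklore] -/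
theorem and_mem_monotoneACBasis (m : ℕ) : GateFn.and m ∈ monotoneACBasis :=
  Set.mem_iUnion.2 ⟨m, Set.mem_insert _ _⟩

/-- `∨ₘ ∈ {∧ₘ, ∨ₘ | m}`. [folklore] -/
theorem or_mem_monotoneACBasis (m : ℕ) : GateFn.or m ∈ monotoneACBasis :=
  Set.mem_iUnion.2 ⟨m, Set.mem_insert_of_mem _ rfl⟩

/-- Over the negation-free basis `{∧ₘ, ∨ₘ | m}` every gate weighs `1` for `acWeight`, so the
depth (all gates weight `1`) is at most — in fact equal to — the `acDepth`. [folklore] -/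
theorem Circuit.depth_le_acDepth_of_isOver_monotoneACBasis {C : Circuit ι}
    (h : C.IsOver monotoneACBasis) : C.depth ≤ C.acDepth := by
  have hw : ∀ g ∈ C.gates, (fun _ => 1 : GateFn → ℕ) g.fn ≤ acWeight g.fn := by
    intro g hg
    obtain ⟨m, hm⟩ := Set.mem_iUnion.1 (h g hg)
    rcases hm with hm | hm
    · simp [hm]
    · rw [Set.mem_singleton_iff] at hm
      simp [hm]
  change C.depthWith (fun _ => 1) ≤ C.depthWith acWeight
  rw [circuit_depthWith, circuit_depthWith]
  cases C.output with
  | inl i => exact le_rfl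
  | inr m => exact getD_wdepths_le_of_forall_mem C.gates hw m

/-- **The exhaustive clique DNF** `⋁_{A ∈ ([n] choose k)} ⋀_{e ⊆ A} x_e`: a depth-`2` circuit over
`{∧ₘ, ∨ₘ | m}` with `C(n,k) + 1` gates computing `k`-CLIQUE on `n` vertices exactly
(Alon–Boppana 1987, §3: CLIQUE is the OR over `k`-sets of the AND of their edges). [folklore] -/
theorem exists_cliqueDNF_monotoneAC (n k : ℕ) :
    ∃ C : Circuit ((⊤ : SimpleGraph (Fin n)).edgeSet), C.IsOver monotoneACBasis ∧ C.depth ≤ 2 ∧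
      C.size ≤ n.choose k + 1 ∧ ∀ x, C.eval x = cliqueFn n k x := by
  classical
  -- the `k`-subsets of the vertices, enumerated
  set T : Finset (Finset (Fin n)) := powersetCard k (univ : Finset (Fin n)) with hT
  have hTcard : #T = n.choose k := by rw [hT, card_powersetCard, card_univ, Fintype.card_fin]
  let A : Fin #T → Finset (Fin n) := fun j => (T.equivFin.symm j).1
  have hA_mem : ∀ j, A j ∈ T := fun j => (T.equivFin.symm j).2
  have hA_surj : ∀ S ∈ T, ∃ j, A j = S := fun S hS =>
    ⟨T.equivFin ⟨S, hS⟩, by simp [A]⟩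
  -- for each vertex set `S`, its edges, enumerated
  let E : Finset (Fin n) → Finset ((⊤ : SimpleGraph (Fin n)).edgeSet) := fun S =>
    univ.filter fun e => cliqueVec S e = true
  let edge : (S : Finset (Fin n)) → Fin #(E S) → (⊤ : SimpleGraph (Fin n)).edgeSet :=
    fun S i => ((E S).equivFin.symm i).1
  have hedge_mem : ∀ S i, cliqueVec S (edge S i) = true := fun S i =>
    (Finset.mem_filter.1 ((E S).equivFin.symm i).2).2
  have hedge_surj : ∀ S e, cliqueVec S e = true → ∃ i, edge S i = e := fun S e he =>
    ⟨(E S).equivFin ⟨e, Finset.mem_filter.2 ⟨Finset.mem_univ _, he⟩⟩, by simp [edge]⟩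
  -- level 1: the AND of the edges inside `S`
  have hand : ∀ S : Finset (Fin n), ACRealOver monotoneACBasis
      (fun x => decide (∀ i : Fin #(E S), x (edge S i) = true)) (0 + 1)
      (∑ _i : Fin #(E S), (0 : ℕ) + 1) := fun S =>
    acRealOver_gate (GateFn.and #(E S)) (and_mem_monotoneACBasis _)
      (f := fun i x => x (edge S i)) fun i => acRealOver_input monotoneACBasis (edge S i)
  -- level 2: the OR over the `k`-sets
  have hor : ACRealOver monotoneACBasis
      (fun x => decide (∃ j : Fin #T, decide (∀ i : Fin #(E (A j)), x (edge (A j) i) = true) = true))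
      (0 + 1 + 1) (∑ j : Fin #T, (∑ _i : Fin #(E (A j)), (0 : ℕ) + 1) + 1) :=
    acRealOver_gate (GateFn.or #T) (or_mem_monotoneACBasis _)
      (f := fun j x => decide (∀ i : Fin #(E (A j)), x (edge (A j) i) = true)) fun j => hand (A j)
  -- semantics: this is `k`-CLIQUE
  have hsem : ∀ x, decide (∃ j : Fin #T,
      decide (∀ i : Fin #(E (A j)), x (edge (A j) i) = true) = true) = cliqueFn n k x := by
    intro x
    have key : cliqueFn n k x = true ↔ ∃ S ∈ T, ∀ e, cliqueVec S e = true → x e = true := by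
      rw [← cliqueCount_ne_zero_iff, cliqueCount, Finset.card_ne_zero, Finset.filter_nonempty_iff]
    have hclause : ∀ S, (∀ i : Fin #(E S), x (edge S i) = true) ↔
        ∀ e, cliqueVec S e = true → x e = true := by
      intro S
      constructor
      · intro h e he
        obtain ⟨i, rfl⟩ := hedge_surj S e he
        exact h i
      · intro h i
        exact h _ (hedge_mem S i)
    rw [Bool.eq_iff_iff, key, decide_eq_true_eq]
    simp only [decide_eq_true_eq, hclause]
    constructor
    · rintro ⟨j, hj⟩
      exact ⟨A j, hA_mem j, hj⟩
    · rintro ⟨S, hS, h⟩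
      obtain ⟨j, rfl⟩ := hA_surj S hS
      exact ⟨j, h⟩
  -- extraction
  have hsize : ∑ j : Fin #T, (∑ _i : Fin #(E (A j)), (0 : ℕ) + 1) + 1 ≤ n.choose k + 1 := by
    simp [hTcard]
  obtain ⟨C, hB, hdep, hs, hC⟩ := ((hor.congr hsem).mono le_rfl hsize).toCircuit
  exact ⟨C, hB, (Circuit.depth_le_acDepth_of_isOver_monotoneACBasis hB).trans hdep, hs, hC⟩

/-- **Discharge of `Rossman2010_upperBound`** (Rossman 2010, Theorem 3, p. 4, AS VENDORED: the
exponent shift `c` may depend on `k`). Witness: depth `d = 2`, `c = 3k/4 + 1`, and `C n` the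
exhaustive clique DNF of `exists_cliqueDNF_monotoneAC` (size `≤ C(n,k) + 1 ≤ n^{k+1}` for
`n ≥ 2`, error probability `0` for every edge density `p`). See the module docstring: the
`k`-uniform exponent `k/4 + O(1)` of the printed proof (§8, Lemma 21) is a stronger statement
than the one recorded by `Rossman2010_upperBound`. [cite: Rossman2010, Thm 3 (p. 4); §8 (pp. 10–11)] -/
theorem Rossman2010_upperBound_holds : Rossman2010_upperBound := by
  intro k hk
  choose C hB hd hs hC using fun n => exists_cliqueDNF_monotoneAC n k
  refine ⟨2, 3 * (k : ℝ) / 4 + 1, C, hB, hd, ?_, ?_⟩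
  · filter_upwards [eventually_ge_atTop 2] with n hn
    have h1 : ((C n).size : ℝ) ≤ (n.choose k : ℝ) + 1 := by exact_mod_cast hs n
    have h2 : (n.choose k : ℝ) ≤ (n : ℝ) ^ k := by exact_mod_cast Nat.choose_le_pow n k
    have hn2 : (2 : ℝ) ≤ n := by exact_mod_cast hn
    have h3 : (n : ℝ) ^ k + 1 ≤ (n : ℝ) ^ (k + 1) := by
      have hpow : (1 : ℝ) ≤ (n : ℝ) ^ k := one_le_pow₀ (by linarith)
      rw [pow_succ]
      nlinarith
    have h4 : (n : ℝ) ^ ((k : ℝ) / 4 + (3 * (k : ℝ) / 4 + 1)) = (n : ℝ) ^ (k + 1) := by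
      rw [show (k : ℝ) / 4 + (3 * (k : ℝ) / 4 + 1) = ((k + 1 : ℕ) : ℝ) by push_cast; ring,
        Real.rpow_natCast]
    rw [h4]
    linarith
  · intro p _hp
    have h0 : ∀ n, gnpProb n (p n) (univ.filter fun x => (C n).eval x ≠ cliqueFn n k x) = 0 := by
      intro n
      rw [Finset.filter_eq_empty_iff.2 (fun x _ => by simp [hC n x]), gnpProb, Finset.sum_empty]
    simp only [SolvesCliqueAAS, h0]
    exact tendsto_const_nhds

end UpperBound

/-!
## Rossman 2010, Theorem 1: the proof (`Rossman2010_cliqueVsSubcritical_holds`)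

Discharge of the named fact `Rossman2010_cliqueVsSubcritical` (Theorem 1, p. 4 of the full
version): for `k ≥ 5`, monotone fan-in-2 circuits of size `O(n^{k/4})` accepting a random
`k`-clique with probability `Ω(1)` accept `G(n, n^{-2(1+δ)/(k-1)})` with probability
`≥ 1 - exp(-n^{Ω(1)})`, for every `0 < δ ≤ k⁻³` (hence both printed readings: all sufficiently
small `δ`, and `δ = k⁻³`). The mathematics is in the sibling files `…Prob` (product measure),
`…Closure` (minterms, ⋆-closure, §5.1), `…Approx` (Lemma 6/9 via the tree's proved spread lemma;
⋆-closed approximation, §5.2), `…Graphs` (combinatorics of `I`, `J`, cliques; exponent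
bookkeeping), `…Counting` (cliques minus an edge, spread of their families) and `…Finite` (the
proof of §6 at one large `n`, `thm1_finite`, under the explicit conditions `LargeN`). This section
only verifies that the conditions `LargeN` hold for all large `n` (`eventually_largeN`: powers
beat constants and logarithms, stretched exponentials beat polynomials) and assembles the
sequence form `Rossman2010Thm1At k δ` (`rossman2010Thm1At_of_le`).

Deviation from the printed proof: both applications of Janson's inequality (Lemma 6 ⇒ Lemma 9,
and Lemma 15) are replaced by the PROVED spread lemma
(`Literature.Combinatorics.SetFamily.spread_lemma_spreadConst`), which yields Rossman's
`(p, q)`-sunflowers with the same exponents; the final optimisation over `H ∈ J` is `medJ_ineq`.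
-/

section Theorem1

open Real Literature.Combinatorics.SetFamily

/-! ### Routine asymptotics along `n : ℕ` -/

/-- Eventually `A ≤ n^c` (`c > 0`). [folklore] -/
theorem eventually_const_le_rpow {c : ℝ} (hc : 0 < c) (A : ℝ) :
    ∀ᶠ n : ℕ in atTop, A ≤ (n : ℝ) ^ c :=
  ((tendsto_rpow_atTop hc).comp tendsto_natCast_atTop_atTop).eventually_ge_atTop A

/-- Eventually `A ≤ B · n^c` (`c, B > 0`). [folklore] -/
theorem eventually_const_le_mul_rpow {c B : ℝ} (hc : 0 < c) (hB : 0 < B) (A : ℝ) :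
    ∀ᶠ n : ℕ in atTop, A ≤ B * (n : ℝ) ^ c :=
  (((tendsto_rpow_atTop hc).comp tendsto_natCast_atTop_atTop).const_mul_atTop hB).eventually_ge_atTop A

/-- Eventually `A · n^{-c} < ε` (`c, ε > 0`). [folklore] -/
theorem eventually_mul_rpow_neg_lt {c ε : ℝ} (hc : 0 < c) (hε : 0 < ε) (A : ℝ) :
    ∀ᶠ n : ℕ in atTop, A * (n : ℝ) ^ (-c) < ε := by
  have h : Tendsto (fun n : ℕ => A * (n : ℝ) ^ (-c)) atTop (𝓝 (A * 0)) :=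
    ((tendsto_rpow_neg_atTop hc).comp tendsto_natCast_atTop_atTop).const_mul A
  rw [mul_zero] at h
  exact h.eventually (gt_mem_nhds hε)

/-- Eventually `exp(-n^c) ≤ ε` (`c, ε > 0`). [folklore] -/
theorem eventually_exp_neg_rpow_le {c ε : ℝ} (hc : 0 < c) (hε : 0 < ε) :
    ∀ᶠ n : ℕ in atTop, Real.exp (-((n : ℝ) ^ c)) ≤ ε := by
  have h : Tendsto (fun n : ℕ => Real.exp (-((n : ℝ) ^ c))) atTop (𝓝 0) :=
    Real.tendsto_exp_atBot.comp (tendsto_neg_atTop_atBot.comp ((tendsto_rpow_atTop hc).comp tendsto_natCast_atTop_atTop))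
  exact h.eventually (ge_mem_nhds hε) |>.mono fun n hn => hn

/-- Eventually `n^{c'} ≤ B · n^c` for `c' < c`, `B > 0`. [folklore] -/
theorem eventually_rpow_le_mul_rpow {c c' B : ℝ} (hcc' : c' < c) (hB : 0 < B) :
    ∀ᶠ n : ℕ in atTop, (n : ℝ) ^ c' ≤ B * (n : ℝ) ^ c := by
  have h := ((tendsto_rpow_neg_atTop (sub_pos.2 hcc')).comp tendsto_natCast_atTop_atTop).eventually (ge_mem_nhds hB)
  filter_upwards [h, eventually_gt_atTop 0] with n hn hn0
  have hnr : (0 : ℝ) < n := by exact_mod_cast hn0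
  have : (n : ℝ) ^ c' = (n : ℝ) ^ (-(c - c')) * (n : ℝ) ^ c := by
    rw [← Real.rpow_add hnr]; congr 1; ring
  rw [this]
  exact mul_le_mul_of_nonneg_right hn (Real.rpow_nonneg hnr.le _)

/-- Eventually `log n ≤ B · n^c` (`c, B > 0`). [folklore] -/
theorem eventually_log_le_mul_rpow {c B : ℝ} (hc : 0 < c) (hB : 0 < B) :
    ∀ᶠ n : ℕ in atTop, Real.log n ≤ B * (n : ℝ) ^ c := by
  have h := (tendsto_natCast_atTop_atTop (R := ℝ)).eventually ((isLittleO_log_rpow_atTop hc).def hB)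
  filter_upwards [h, eventually_gt_atTop 0] with n hn hn0
  have hnr : (0 : ℝ) < n := by exact_mod_cast hn0
  rw [norm_eq_abs, norm_eq_abs] at hn
  calc Real.log n ≤ |Real.log n| := le_abs_self _
    _ ≤ B * |(n : ℝ) ^ c| := hn
    _ = B * (n : ℝ) ^ c := by rw [abs_of_nonneg (Real.rpow_nonneg hnr.le _)]

/-- **Stretched exponentials beat polynomials**: eventually
`A · n^m · exp(-n^d) ≤ (1/2) exp(-n^{c'})` for `0 < c' < d`. [folklore] -/
theorem eventually_poly_mul_exp_le {A m d c' : ℝ} (hd : 0 < d) (hc'd : c' < d) :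
    ∀ᶠ n : ℕ in atTop, A * (n : ℝ) ^ m * Real.exp (-((n : ℝ) ^ d)) ≤
      1 / 2 * Real.exp (-((n : ℝ) ^ c')) := by
  have h1 := eventually_log_le_mul_rpow (c := d) hd (B := 1 / (4 * (|m| + 1))) (by positivity)
  have h2 := eventually_rpow_le_mul_rpow (c := d) (c' := c') hc'd (B := 1 / 4) (by norm_num)
  have h3 := eventually_const_le_mul_rpow (c := d) hd (B := 1 / 4) (by norm_num) (Real.log (2 * |A| + 1))
  filter_upwards [h1, h2, h3, eventually_gt_atTop 0] with n hlog hpow hconst hn0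
  have hnr : (0 : ℝ) < n := by exact_mod_cast hn0
  have hnd : 0 ≤ (n : ℝ) ^ d := Real.rpow_nonneg hnr.le _
  -- it suffices to bound `|A| n^m exp(-n^d)`
  have hA : A * (n : ℝ) ^ m * Real.exp (-((n : ℝ) ^ d)) ≤ |A| * (n : ℝ) ^ m * Real.exp (-((n : ℝ) ^ d)) :=
    mul_le_mul_of_nonneg_right (mul_le_mul_of_nonneg_right (le_abs_self A) (Real.rpow_nonneg hnr.le _))
      (Real.exp_pos _).le
  refine hA.trans ?_
  -- write everything as one exponential
  have hlog0 : 0 ≤ Real.log n := Real.log_nonneg (by exact_mod_cast hn0)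
  have hm : m * Real.log n ≤ (|m| + 1) * Real.log n := by nlinarith [le_abs_self m]
  have hml : (|m| + 1) * Real.log n ≤ 1 / 4 * (n : ℝ) ^ d := by
    have := mul_le_mul_of_nonneg_left hlog (by positivity : (0 : ℝ) ≤ |m| + 1)
    refine this.trans (le_of_eq ?_)
    field_simp
  have key : Real.log (2 * |A| + 1) + m * Real.log n + (n : ℝ) ^ c' - (n : ℝ) ^ d ≤ -((n : ℝ) ^ c') := by
    nlinarith
  have hexp : (2 * |A| + 1) * (n : ℝ) ^ m * Real.exp (-((n : ℝ) ^ d)) * Real.exp ((n : ℝ) ^ c') ≤ 1 := by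
    have hpos : (0 : ℝ) < 2 * |A| + 1 := by positivity
    rw [Real.rpow_def_of_pos hnr, ← Real.exp_log hpos, ← Real.exp_add, ← Real.exp_add, ← Real.exp_add]
    rw [Real.exp_le_one_iff]
    nlinarith [Real.rpow_nonneg hnr.le c']
  have hec : 0 < Real.exp ((n : ℝ) ^ c') := Real.exp_pos _
  have hecn : Real.exp (-((n : ℝ) ^ c')) = (Real.exp ((n : ℝ) ^ c'))⁻¹ := Real.exp_neg _
  rw [hecn, show 1 / 2 * (Real.exp ((n : ℝ) ^ c'))⁻¹ = 1 / (2 * Real.exp ((n : ℝ) ^ c')) by ring,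
    le_div_iff₀ (by positivity)]
  have hnm : 0 ≤ (n : ℝ) ^ m * Real.exp (-((n : ℝ) ^ d)) * Real.exp ((n : ℝ) ^ c') := by positivity
  nlinarith [abs_nonneg A]

/-- Eventually `exp(-n^c) ≤ (1/2) exp(-n^{c'})` for `0 < c' < c`. [folklore] -/
theorem eventually_exp_le_half_exp {c c' : ℝ} (hc : 0 < c) (hc'c : c' < c) :
    ∀ᶠ n : ℕ in atTop, Real.exp (-((n : ℝ) ^ c)) ≤ 1 / 2 * Real.exp (-((n : ℝ) ^ c')) := by
  have := eventually_poly_mul_exp_le (A := 1) (m := 0) hc hc'c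
  filter_upwards [this] with n hn
  simpa [Real.rpow_zero] using hn

/-! ### The largeness conditions hold eventually -/

/-- **All conditions of `LargeN` hold for every sufficiently large `n`.** [folklore] -/
theorem eventually_largeN {k : ℕ} (hk : 5 ≤ k) {δ : ℝ} (hδ0 : 0 < δ) (hδ1 : δ ≤ 1 / (k : ℝ) ^ 3)
    (c₀ η : ℝ) (hη : 0 < η) : ∀ᶠ n : ℕ in atTop, LargeN k δ c₀ η n := by
  have hk' : (5 : ℝ) ≤ k := by exact_mod_cast hk
  have hc := cExp_pos hk hδ0 hδ1
  have hcp := cPrime_pos hk hδ0 hδ1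
  obtain ⟨hcpc, hcpδ⟩ := cPrime_lt hk hδ0 hδ1
  have hs := slack_pos hk hδ0 hδ1
  have ha : 0 < 2 * (1 + δ) / ((k : ℝ) - 1) := div_pos (by linarith) (by linarith)
  -- the individual conditions
  have e1 := eventually_ge_atTop k
  have e2 : ∀ᶠ n : ℕ in atTop, pMinus k δ n < 1 / 2 := by
    have := ((tendsto_rpow_neg_atTop ha).comp tendsto_natCast_atTop_atTop).eventually (gt_mem_nhds (by norm_num : (0 : ℝ) < 1 / 2))
    filter_upwards [this] with n hn
    rw [pMinus, neg_div]; exact hn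
  have e3 := eventually_exp_neg_rpow_le hδ0 (by norm_num : (0 : ℝ) < 1 / 2)
  have e4 := eventually_exp_neg_rpow_le hc (by norm_num : (0 : ℝ) < 1 / 2)
  have e5 := eventually_const_le_rpow hδ0 (Real.log ((k : ℝ) ^ 2))
  have e6 := eventually_const_le_rpow hc (Real.log (k.choose 2 : ℝ))
  have e7 := eventually_const_le_rpow hc (2 * spreadConst)
  have e8 := eventually_const_le_mul_rpow (c := slack k δ / 2) (by positivity) hη (2 * (k : ℝ) ^ k)
  have e9 := eventually_mul_rpow_neg_lt (c := 1 / 8) (by norm_num) (half_pos hη)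
    (max c₀ 1 * ((k * (k ^ 2 + 1) : ℕ) : ℝ) * ((2 * spreadConst) ^ (k ^ 2) * (k : ℝ) ^ k))
  have e10 := eventually_exp_le_half_exp hc hcpc
  have e11 := eventually_poly_mul_exp_le (A := max c₀ 1 * (2 : ℝ) ^ (k ^ 2)) (m := (k : ℝ) / 4 + k)
    hδ0 hcpδ
  filter_upwards [e1, e2, e3, e4, e5, e6, e7, e8, e9, e10, e11] with n h1 h2 h3 h4 h5 h6 h7 h8 h9 h10 h11
  refine ⟨h1, h2, h3, h4, h5, h6, h7, h8, h9, ?_⟩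
  rw [tThr]
  linarith

/-! ### Theorem 1 -/

/-- **Rossman 2010, Theorem 1, for every `0 < δ ≤ k⁻³`** (`k ≥ 5`): `Rossman2010Thm1At k δ`.
[cite: Rossman2010, Thm 1 (p. 4)] -/
theorem rossman2010Thm1At_of_le {k : ℕ} (hk : 5 ≤ k) {δ : ℝ} (hδ0 : 0 < δ)
    (hδ1 : δ ≤ 1 / (k : ℝ) ^ 3) : Rossman2010Thm1At k δ := by
  rintro C hC ⟨c₀, hc₀⟩ ⟨η, hη, hacc⟩
  refine ⟨cPrime k δ, cPrime_pos hk hδ0 hδ1, ?_⟩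
  filter_upwards [hC, hc₀, hacc, eventually_largeN hk hδ0 hδ1 c₀ η hη] with n h1 h2 h3 h4
  exact thm1_finite hk hδ0 hδ1 hη h4 (C n) h1 h2 h3

/-- **Rossman 2010, Theorem 1** — discharge of the named fact `Rossman2010_cliqueVsSubcritical`:
for `k ≥ 5`, Theorem 1 holds for all `δ ∈ (0, δ₀]` with `δ₀ = k⁻³`, and in particular for
`δ = k⁻³` ("Fix sufficiently small `δ > 0` (to be determined later, though `δ = k⁻³` suffices)",
p. 4). [cite: Rossman2010, Thm 1 (p. 4)] -/
theorem Rossman2010_cliqueVsSubcritical_holds : Rossman2010_cliqueVsSubcritical := by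
  intro k hk
  have hk0 : (0 : ℝ) < 1 / (k : ℝ) ^ 3 := by
    have : (0 : ℝ) < k := by exact_mod_cast (show 0 < k by omega)
    positivity
  exact ⟨⟨1 / (k : ℝ) ^ 3, hk0, fun δ hδ0 hδ1 => rossman2010Thm1At_of_le hk hδ0 hδ1⟩,
    rossman2010Thm1At_of_le hk hk0 le_rfl⟩

end Theorem1

end Literature.Computability.Complexity
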